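import Summits.KontsevichZagierPeriods.Zeta5Search.Certificates.RayKernelMultiplier
import HarnessLib

/-!
# ζ(5) search — certificates: the GENERIC atlas-cell certificate for the kernel multiplier (TYPER g16)

HONEST FRAMING: systematic search; no irrationality claim unless certified.  `p`-adic bookkeeping of explicit rationals;
nothing here is a statement about `ζ(5)`.

OUR work (Summit side; typer seat, generation 16).  Sequel of `Certificates/RayKernelMultiplier`; the ray-independent form of
typer g15's `RecordRay.cell_core`.  The census ATLAS of a ray is a list of typed `θ`-windows with a PROVED bound
`B ≤ v_p(Cas₇(b))` on the contiguity Casoratian `Cas₇(b) = W(b′)V(b) − W(b)V(b′)` (`Ray4Windows.*`, `T1Rays.Ray5Window*`,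
`T1Rays.Ray1Window*`, … — gen-2 / p3 / typer g14 machines).  Since the multiplied wedge is `wedgeNum = d⁹·N♯(b)N♯(b′)·Cas₇(b)`
and the multiplied Q-minor is `qNum = d⁹·N♯(b)N♯(b′)·(UW′ − U′W)`, such a bound is a divisibility certificate:

* `wedgeNum_eq`, `qNum_eq` — the two factorisations;
* **`cell_cert`** — with `v_p(d) = 1`, `v_p(N♯(b)) = vN`, `v_p(N♯(b′)) = vN′`, a Casoratian floor `B` and a Q-minor floor `B_Q`,
  every `k ≤ 9 + vN + vN′ + B`, `k ≤ 9 + vN + vN′ + B_Q` gives `p^k ∣ wedgeNumZ b b′` and `p^k ∣ qNumZ b b′`;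
* `qminor_floor_of_int` — if `ρ·(UW′ − U′W)` is an INTEGER `Q` (the Q-part of the wedge dictionary, PROVED per ray:
  `RayH1.h1Q_eq_wedge`, …) then `B_Q = −v_p(ρ)` is a Q-minor floor.

Per ray, `vN`, `vN′`, `v_p(ρ(a·n))` are explicit single-digit Legendre sums for `p > n` (pattern: `RecordRayDenominatorsCellCore`);
that instantiation is left to the ray files.
-/

noncomputable section

open Finset

namespace Summit.KontsevichZagierPeriods.Zeta5Search.RayKernel

open Summit.KontsevichZagierPeriods.Zeta5Search.DualSeries
open Summit.KontsevichZagierPeriods.Zeta5Search.DualSeriesDenominators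
open Summit.KontsevichZagierPeriods.Zeta5Search.WedgeDictionary

variable {b b' : ℕ → ℤ} {p : ℕ} [hp : Fact p.Prime]

omit hp in
/-- **`wedgeNum = d⁹·N♯(b)·N♯(b′)·(W(b′)V(b) − W(b)V(b′))`** (the partner has the same `b₀`). -/
theorem wedgeNum_eq (h0 : bn b' 0 = bn b 0) :
    wedgeNum b b' = dOf0 b ^ 9 * sharpNormaliser b * sharpNormaliser b' * (coeffW b' * coeffV b - coeffW b * coeffV b') := by
  have hd : dOf0 b' = dOf0 b := by unfold dOf0; rw [h0]
  unfold wedgeNum zW zV; rw [hd]; ring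

omit hp in
/-- **`qNum = d⁹·N♯(b)·N♯(b′)·(U(b)W(b′) − U(b′)W(b))`**. -/
theorem qNum_eq (h0 : bn b' 0 = bn b 0) :
    qNum b b' = dOf0 b ^ 9 * sharpNormaliser b * sharpNormaliser b' * (coeffU b * coeffW b' - coeffU b' * coeffW b) := by
  have hd : dOf0 b' = dOf0 b := by unfold dOf0; rw [h0]
  unfold qNum zU zW; rw [hd]; ring

/-- `N♯(b) ≠ 0`. -/
private theorem sharpNormaliser_ne_zero (b : ℕ → ℤ) : sharpNormaliser b ≠ 0 := by
  unfold sharpNormaliser normaliser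
  exact div_ne_zero (by exact_mod_cast (prod_pos fun s _ => Nat.factorial_pos _).ne')
    (by exact_mod_cast (mul_pos (Nat.factorial_pos _) (Nat.factorial_pos _)).ne')

/-- The valuation of `d⁹·N♯·N♯′·x` for `x ≠ 0`: `9·v_p(d) + v_p(N♯) + v_p(N♯′) + v_p(x)`. -/
theorem padicValRat_core_mul (x : ℚ) (hx : x ≠ 0) :
    padicValRat p (dOf0 b ^ 9 * sharpNormaliser b * sharpNormaliser b' * x) =
      9 * padicValRat p (dOf0 b) + padicValRat p (sharpNormaliser b) + padicValRat p (sharpNormaliser b') + padicValRat p x := by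
  have hd : dOf0 b ≠ 0 := (dOf0_pos b).ne'
  have hN := sharpNormaliser_ne_zero b
  have hN' := sharpNormaliser_ne_zero b'
  rw [padicValRat.mul (mul_ne_zero (mul_ne_zero (pow_ne_zero _ hd) hN) hN') hx,
    padicValRat.mul (mul_ne_zero (pow_ne_zero _ hd) hN) hN', padicValRat.mul (pow_ne_zero _ hd) hN, padicValRat.pow]
  push_cast; ring

/-- **The atlas-cell certificate.**  For an admissible pair `(b, b′)` with `b′₀ = b₀`, a prime with `v_p(d_{b₀}) = 1`,
`v_p(N♯(b)) = vN`, `v_p(N♯(b′)) = vN′`, a Casoratian floor `B ≤ v_p(W(b′)V(b) − W(b)V(b′))` and a Q-minor floor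
`B_Q ≤ v_p(U(b)W(b′) − U(b′)W(b))` (each only when nonzero), every `k ≤ 9 + vN + vN′ + B`, `k ≤ 9 + vN + vN′ + B_Q` satisfies
`p^k ∣ wedgeNumZ b b′` and `p^k ∣ qNumZ b b′`. -/
theorem cell_cert (hb : SharpAdmissible b) (hb' : SharpAdmissible b') (h0 : bn b' 0 = bn b 0)
    (hd : padicValRat p (dOf0 b) = 1) {vN vN' : ℤ} (hvN : padicValRat p (sharpNormaliser b) = vN)
    (hvN' : padicValRat p (sharpNormaliser b') = vN') {B BQ : ℤ}
    (hcas : coeffW b' * coeffV b - coeffW b * coeffV b' ≠ 0 → B ≤ padicValRat p (coeffW b' * coeffV b - coeffW b * coeffV b'))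
    (hq : coeffU b * coeffW b' - coeffU b' * coeffW b ≠ 0 → BQ ≤ padicValRat p (coeffU b * coeffW b' - coeffU b' * coeffW b))
    {k : ℕ} (hk : (k : ℤ) ≤ 9 + vN + vN' + B) (hkq : (k : ℤ) ≤ 9 + vN + vN' + BQ) :
    (p : ℤ) ^ k ∣ wedgeNumZ b b' ∧ (p : ℤ) ^ k ∣ qNumZ b b' := by
  have hd0 : dOf0 b ≠ 0 := (dOf0_pos b).ne'
  have hN := sharpNormaliser_ne_zero b
  have hN' := sharpNormaliser_ne_zero b'
  have hcore : dOf0 b ^ 9 * sharpNormaliser b * sharpNormaliser b' ≠ 0 :=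
    mul_ne_zero (mul_ne_zero (pow_ne_zero _ hd0) hN) hN'
  constructor
  · refine pow_dvd_of_le_padicValRat (x := wedgeNum b b') (wedgeNumZ_cast hb hb').symm fun hx => ?_
    rw [wedgeNum_eq h0] at hx ⊢
    have hx' : coeffW b' * coeffV b - coeffW b * coeffV b' ≠ 0 := right_ne_zero_of_mul hx
    rw [padicValRat_core_mul _ hx', hd, hvN, hvN']
    have := hcas hx'
    linarith
  · refine pow_dvd_of_le_padicValRat (x := qNum b b') (qNumZ_cast hb hb').symm fun hx => ?_
    rw [qNum_eq h0] at hx ⊢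
    have hx' : coeffU b * coeffW b' - coeffU b' * coeffW b ≠ 0 := right_ne_zero_of_mul hx
    rw [padicValRat_core_mul _ hx', hd, hvN, hvN']
    have := hq hx'
    linarith

/-- **Q-minor floor from integrality.**  If `ρ·(U(b)W(b′) − U(b′)W(b))` is an integer `Q` (the Q-part of the wedge dictionary)
and `ρ ≠ 0`, then `−v_p(ρ) ≤ v_p(U(b)W(b′) − U(b′)W(b))` whenever the minor is nonzero. -/
theorem qminor_floor_of_int {ρ : ℚ} (hρ : ρ ≠ 0) {Q : ℤ}
    (hQ : (Q : ℚ) = ρ * (coeffU b * coeffW b' - coeffU b' * coeffW b)) :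
    coeffU b * coeffW b' - coeffU b' * coeffW b ≠ 0 →
      -padicValRat p ρ ≤ padicValRat p (coeffU b * coeffW b' - coeffU b' * coeffW b) := by
  intro hx
  have hQ0 : (Q : ℚ) ≠ 0 := by rw [hQ]; exact mul_ne_zero hρ hx
  have hval : padicValRat p (Q : ℚ) = padicValRat p ρ + padicValRat p (coeffU b * coeffW b' - coeffU b' * coeffW b) := by
    rw [hQ, padicValRat.mul hρ hx]
  have hQv : 0 ≤ padicValRat p (Q : ℚ) := by rw [padicValRat.of_int]; positivity
  linarith

end Summit.KontsevichZagierPeriods.Zeta5Search.RayKernel
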